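import Summits.KontsevichZagierPeriods.KontsevichZagierPeriods.Theorems.RealOnePeriodRelations.Negative.GreenSound
import Summits.KontsevichZagierPeriods.KontsevichZagierPeriods.Theorems.RealOnePeriodRelations.Negative.CoherenceLocalArcs
import Mathlib.MeasureTheory.Function.LocallyIntegrable
import Mathlib.Analysis.Convex.Contractible
import Mathlib.AlgebraicTopology.FundamentalGroupoid.SimplyConnected

/-!
# `RealOnePeriodRelations` (stmt-KontsevichZagierPeriods-10042) — negative side: COHERENCE IS LOCAL
# (stubs `stub_stripGreenData` / `coherence_of` / `stub_retraction` (ii) of line `nash-retraction-thin-strip`;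
# drefute, part 3 of 3)

On `𝔾ₘ = {xy = 1}` the two semialgebraic arcs `x = (2t−1) ± i(t²−t)` from `(−1,−1)` to `(1,1)`
(`Negative/CoherenceLocalArcs`) are `8`-replacements of each other, but the real realisations of
`i · y dx = i·dx/x` along them have values differing by the period (each arc sweeps `∓π` around the
puncture; only the sign is certified here: `value [arc₁] − value [arc₋₁] = −2∫₀¹ h < 0`), hence are NOT
congruent modulo the sound subgroup `M₁`. So no `ε ≥ 8` is a coherence radius for the lower arc
(`not_isCoherenceRadius_arc`), and the `∃ ε` of the line's `coherence_of` / the hypothesis shape of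
`stub_retraction` (2) cannot be strengthened to `∀ ε > 0` (`not_forall_isCoherenceRadius`): coherence sees
the homotopy class rel end points — the typed witness behind the R4 plan gap of `stub_retraction`
(isogenies `[N]` stretch replacements beyond every fixed radius).

§3 (added for reshape 2 of the line, whose `stub_homotopyInvariance` asks the homotopy as `Path`s in the SUBTYPE
`↥Z.points`): that typing is load-bearing — with the homotopy taken in the AMBIENT `ℂⁿ` (contractible, so any two paths
with the same end points are homotopic) homotopy coherence is FALSE (`homotopyInvariance_false_with_ambient_homotopy`),
by the same two arcs (`arcAmbientPath`).
-/

noncomputable section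

open scoped BigOperators Topology ComplexConjugate unitInterval
open Set MeasureTheory Filter
open Literature.NumberTheory.Transcendental Literature.NumberTheory.Transcendental.CurvePeriods
open Literature.ModelTheory.ExponentialFields (IsSemialgebraic isSemialgebraic_setOf_eval_nonneg
  isSemialgebraic_setOf_eval_le isSemialgebraic_setOf_eval_pos isSemialgebraic_setOf_eval_eq_zero)

namespace Summit.KontsevichZagierPeriods.SymplecticScissors.RealOnePeriodRelationsNegative.Stubs

/-! ## §1 The real realisations of `i · y dx` along the arcs and their values -/

/-- `ω = y dx`: the polynomial 1-form `X₁ dx₀ + 0 dx₁` on `ℂ²` (`= dx/x` on `𝔾ₘ`). [folklore] -/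
def omegaGm : Fin 2 → MvPolynomial (Fin 2) ℂ := ![MvPolynomial.X 1, 0]

/-- `ω` is defined over `ℚ`. [folklore] -/
theorem hasAlgCoeffs_omegaGm (i : Fin 2) : HasAlgCoeffs (omegaGm i) := by
  have h : omegaGm i = MvPolynomial.map (algebraMap ℚ ℂ)
      ((![MvPolynomial.X 1, 0] : Fin 2 → MvPolynomial (Fin 2) ℚ) i) := by
    fin_cases i <;> simp [omegaGm, MvPolynomial.map_X]
  intro d
  rw [h, MvPolynomial.coeff_map]
  exact isAlgebraic_algebraMap _

/-- `i` is algebraic (`i² + 1 = 0`). [folklore] -/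
theorem isAlgebraic_I : IsAlgebraic ℚ Complex.I := by
  refine ⟨Polynomial.X ^ 2 + 1, ?_, ?_⟩
  · intro h
    have := congrArg (Polynomial.eval 0) h
    simp at this
  · simp

/-- The realising integrand `Re(i · Σᵢ ωᵢ(γ) γᵢ′)` along the arc, LITERALLY in the shape of `Realises`. [folklore] -/
def arcIntegrand (s : ℚ) (z : Fin 1 → ℝ) : ℝ :=
  (Complex.I * ∑ i, MvPolynomial.eval (arcFun s (z 0)) (omegaGm i) * deriv (fun u => arcFun s u i) (z 0)).re

/-- Its closed form `g_s(t) = −s(2t² − 2t + 1)/|D s t|²` (`= −Im(D′/D) = −(d/dt) arg D`). [folklore] -/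
def gFun (s : ℚ) (t : ℝ) : ℝ := -((s : ℝ) * (2 * t ^ 2 - 2 * t + 1)) / Complex.normSq (D s t)

/-- `deriv D`. [folklore] -/
theorem deriv_D (s : ℚ) (t : ℝ) :
    deriv (D s) t = ((2 : ℝ) : ℂ) + (((s : ℝ) * (2 * t - 1) : ℝ) : ℂ) * Complex.I :=
  (hasDerivAt_D s t).deriv

/-- `Re(i · y · x′) = −s(2t²−2t+1)/|D|²` along the arc. [folklore] -/
theorem arcIntegrand_eq {s : ℚ} (hs : s ≠ 0) (z : Fin 1 → ℝ) : arcIntegrand s z = gFun s (z 0) := by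
  unfold arcIntegrand gFun
  rw [Fin.sum_univ_two]
  have hd : (fun u => arcFun s u 0) = D s := rfl
  simp only [omegaGm, Matrix.cons_val_zero, Matrix.cons_val_one, MvPolynomial.eval_X, map_zero,
    zero_mul, add_zero, arcFun_one, hd, deriv_D]
  have hq : Complex.normSq (D s (z 0)) ≠ 0 := (normSq_D_pos hs (z 0)).ne'
  rw [Complex.inv_def]
  simp only [Complex.mul_re, Complex.mul_im, Complex.add_re, Complex.add_im, Complex.conj_re,
    Complex.conj_im, Complex.ofReal_re, Complex.ofReal_im, Complex.I_re, Complex.I_im, D_re, D_im]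
  field_simp
  ring

/-- `g_s` is continuous (the denominator never vanishes). [folklore] -/
theorem continuous_gFun {s : ℚ} (hs : s ≠ 0) : Continuous (gFun s) := by
  unfold gFun
  have hD : Continuous (D s) := by
    unfold D
    fun_prop
  refine Continuous.div (by fun_prop) (Complex.continuous_normSq.comp hD) fun t => (normSq_D_pos hs t).ne'

/-- `unitDom ⊆ [0,1]¹`. [folklore] -/
theorem unitDom_subset_Icc : unitDom ⊆ Set.Icc (0 : Fin 1 → ℝ) 1 := by
  intro z hz
  have hz' : z 0 ∈ Set.Ioo (0 : ℝ) 1 := hz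
  refine ⟨fun i => ?_, fun i => ?_⟩
  · have : i = 0 := Subsingleton.elim i 0
    subst this
    simpa using hz'.1.le
  · have : i = 0 := Subsingleton.elim i 0
    subst this
    simpa using hz'.2.le

/-- The real realisation `[∫₀¹ Re(i · y x′) dt]` of `i · (ω, arc_s)`. [folklore] -/
def arcRep (s : ℚ) (hs : s ≠ 0) : KZ.IntegralRep 1 where
  domain := unitDom
  integrand := arcIntegrand s
  isSemialgebraic_domain := isSemialgebraic_unitDom
  isSemialgebraicFunOn_integrand := by
    refine (isSemialgebraicFunOn_aeval_div_aeval isSemialgebraic_unitDom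
      (-(MvPolynomial.C s * (2 * MvPolynomial.X 0 ^ 2 - 2 * MvPolynomial.X 0 + 1)) : MvPolynomial (Fin 1) ℚ)
      (qPoly s) fun x _ => aeval_qPoly_ne_zero hs x).congr ?_
    intro x _
    dsimp only
    rw [arcIntegrand_eq hs, gFun, aeval_qPoly]
    simp [neg_div]
  integrableOn := by
    have hcont : Continuous fun z : Fin 1 → ℝ => gFun s (z 0) :=
      (continuous_gFun hs).comp (continuous_apply 0)
    have h1 : IntegrableOn (fun z : Fin 1 → ℝ => gFun s (z 0)) (Set.Icc 0 1) volume :=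
      hcont.integrableOn_Icc
    exact (h1.mono_set unitDom_subset_Icc).congr_fun (fun z _ => (arcIntegrand_eq hs z).symm)
      measurableSet_unitDom

/-- `value [arcRep s] = ∫₀¹ g_s`. [folklore] -/
theorem value_arcRep {s : ℚ} (hs : s ≠ 0) : (arcRep s hs).value = ∫ t in (0 : ℝ)..1, gFun s t := by
  unfold KZ.IntegralRep.value
  have hdom : (arcRep s hs).domain = unitDom := rfl
  have hint : (arcRep s hs).integrand = arcIntegrand s := rfl
  rw [hdom, hint, setIntegral_congr_fun measurableSet_unitDom (fun z _ => arcIntegrand_eq hs z)]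
  exact setIntegral_unitDom (gFun s)

/-- The positive density `h(t) = (2t²−2t+1)/((2t−1)² + (t²−t)²)` (`= |d/dt arg D|`). [folklore] -/
def hFun (t : ℝ) : ℝ := (2 * t ^ 2 - 2 * t + 1) / ((2 * t - 1) ^ 2 + (t ^ 2 - t) ^ 2)

/-- The denominator of `h` is `≥ 1/16 > 0`. [folklore] -/
theorem hFun_den_pos (t : ℝ) : 0 < (2 * t - 1) ^ 2 + (t ^ 2 - t) ^ 2 := by
  nlinarith [sq_nonneg (t - 1 / 2), sq_nonneg ((t - 1 / 2) ^ 2)]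

/-- `h > 0`. [folklore] -/
theorem hFun_pos (t : ℝ) : 0 < hFun t := by
  unfold hFun
  refine div_pos ?_ (hFun_den_pos t)
  nlinarith [sq_nonneg (t - 1 / 2)]

/-- `h` is continuous. [folklore] -/
theorem continuous_hFun : Continuous hFun := by
  unfold hFun
  exact Continuous.div (by fun_prop) (by fun_prop) fun t => (hFun_den_pos t).ne'

/-- `g₁ = −h`. [folklore] -/
theorem gFun_one (t : ℝ) : gFun 1 t = -hFun t := by
  unfold gFun hFun
  rw [normSq_D]
  push_cast
  ring

/-- `g₋₁ = h`. [folklore] -/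
theorem gFun_neg_one (t : ℝ) : gFun (-1) t = hFun t := by
  unfold gFun hFun
  rw [normSq_D]
  push_cast
  ring

/-- `∫₀¹ h > 0`. [folklore] -/
theorem integral_hFun_pos : 0 < ∫ t in (0 : ℝ)..1, hFun t :=
  intervalIntegral.intervalIntegral_pos_of_pos_on (continuous_hFun.intervalIntegrable 0 1)
    (fun t _ => hFun_pos t) zero_lt_one

/-- The two realisations have DIFFERENT values: `value [arc₁] − value [arc₋₁] = −2∫₀¹ h < 0`
(each arc sweeps the angle `∓π` around the puncture; the difference is the period `−2π` of `i·dx/x`,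
but only its sign is needed). [folklore] -/
theorem value_arcRep_one_sub_neg_one :
    (arcRep 1 one_ne_zero).value - (arcRep (-1) (by norm_num)).value < 0 := by
  rw [value_arcRep, value_arcRep]
  simp_rw [gFun_one, gFun_neg_one]
  rw [intervalIntegral.integral_neg]
  linarith [integral_hFun_pos]

/-! ## §2 Coherence radii are bounded: no `ε ≥ 8` is a coherence radius for the lower arc on `𝔾ₘ` -/

/-- `‖D s t‖ ≤ 2` on `[0,1]` for `s = ±1`. [folklore] -/
theorem norm_D_le {s : ℚ} (hs : s ^ 2 = 1) {t : ℝ} (ht : t ∈ Set.Icc (0 : ℝ) 1) : ‖D s t‖ ≤ 2 := by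
  have hs' : (s : ℝ) ^ 2 = 1 := by exact_mod_cast hs
  have habs : |(s : ℝ)| = 1 := by
    have := abs_mul_abs_self (s : ℝ)
    nlinarith [abs_nonneg (s : ℝ), sq_abs (s : ℝ)]
  refine (Complex.norm_le_abs_re_add_abs_im _).trans ?_
  rw [D_re, D_im, abs_mul, habs, one_mul]
  have h1 : |2 * t - 1| ≤ 1 := abs_le.mpr ⟨by linarith [ht.1], by linarith [ht.2]⟩
  have h2 : |t ^ 2 - t| ≤ 1 := abs_le.mpr ⟨by nlinarith [ht.1, ht.2], by nlinarith [ht.1, ht.2]⟩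
  linarith

/-- `‖(D s t)⁻¹‖ ≤ 4` for `s = ±1` (since `|D|² ≥ 1/16`). [folklore] -/
theorem norm_inv_D_le {s : ℚ} (hs : s ^ 2 = 1) (t : ℝ) : ‖(D s t)⁻¹‖ ≤ 4 := by
  have hq := normSq_D_ge hs t
  rw [Complex.normSq_eq_norm_sq] at hq
  have hn : 0 ≤ ‖D s t‖ := norm_nonneg _
  have hD : 1 / 4 ≤ ‖D s t‖ := by nlinarith
  have hDpos : 0 < ‖D s t‖ := by linarith
  rw [norm_inv]
  rw [inv_le_comm₀ hDpos (by norm_num)]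
  linarith

/-- Both arcs `s = ±1` are `ε`-replacements of the lower arc for every `ε ≥ 8` (semialgebraic, same
end points `(−1,−1)`, `(1,1)`, and crude sup-norm distance `≤ 8` on `[0,1]`). [folklore] -/
theorem isReplacement_arc {ε : ℝ} (hε : 8 ≤ ε) {s : ℚ} (hs : s ^ 2 = 1) (hs0 : s ≠ 0) :
    IsReplacement (arcPath 1 one_ne_zero) ε (arcPath s hs0) := by
  refine ⟨isSAPath_arcFun hs0, ?_, ?_, ?_⟩
  · show arcFun s 0 = arcFun 1 0
    simp only [arcFun, D_at_zero]
  · show arcFun s 1 = arcFun 1 1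
    simp only [arcFun, D_at_one]
  · intro t ht
    show dist (arcFun s t) (arcFun 1 t) ≤ ε
    rw [dist_pi_le_iff (by linarith)]
    intro i
    fin_cases i
    · show dist (D s t) (D 1 t) ≤ ε
      refine (dist_le_norm_add_norm _ _).trans ?_
      linarith [norm_D_le hs ht, norm_D_le (s := 1) (by norm_num) ht]
    · show dist (D s t)⁻¹ (D 1 t)⁻¹ ≤ ε
      refine (dist_le_norm_add_norm _ _).trans ?_
      linarith [norm_inv_D_le hs t, norm_inv_D_le (s := 1) (by norm_num) t]

/-- **Coherence is local.** For the lower arc `γ` on `𝔾ₘ` no `ε ≥ 8` is a coherence radius: the upper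
arc is an `8`-replacement of `γ` (as is `γ` itself), and the real realisations of `i · y dx = i·dx/x`
along the two arcs differ in value by the period `2π ≠ 0` (here: by `−2∫₀¹h < 0`), hence are not
congruent modulo the sound subgroup `M₁`. So the `∃ ε` of `coherence_of` / `stub_stripGreenData` cannot
be strengthened to large or uniform `ε`: coherence sees the homotopy class rel end points, exactly the
obstruction at R4 in `stub_retraction` (isogenies `[N]` stretch replacements beyond every fixed radius).
[cite: KontsevichZagier2001, §1.2] -/
theorem not_isCoherenceRadius_arc {ε : ℝ} (hε : 8 ≤ ε) :
    ¬ IsCoherenceRadius Gm (arcPath 1 one_ne_zero) ε := by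
  rintro ⟨-, h⟩
  have hmem := h omegaGm hasAlgCoeffs_omegaGm Complex.I isAlgebraic_I (arcPath 1 one_ne_zero)
    (arcPath (-1) (by norm_num)) (isReplacement_arc hε (by norm_num) one_ne_zero)
    (isReplacement_arc hε (by norm_num) (by norm_num)) (arcRep 1 one_ne_zero) (arcRep (-1) (by norm_num))
    ⟨rfl, fun z _ => rfl⟩ ⟨rfl, fun z _ => rfl⟩
  have h0 := eval_eq_zero_of_mem_M₁ hmem
  rw [map_sub, KZ.eval_of, KZ.eval_of] at h0
  linarith [value_arcRep_one_sub_neg_one]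

/-- Hence the hypothesis shape of `stub_retraction` (2) / conclusion of `coherence_of` — `∃ ε,
IsCoherenceRadius Z γ ε` — cannot be strengthened to `∀ ε > 0`. [cite: KontsevichZagier2001, §1.2] -/
theorem not_forall_isCoherenceRadius :
    ¬ ∀ (Z : CurveData), Z.IsSmoothAffineCurve → ∀ (γ : CurvePath Z) (ε : ℝ), 0 < ε →
      IsCoherenceRadius Z γ ε :=
  fun h => not_isCoherenceRadius_arc le_rfl (h Gm isSmoothAffineCurve_Gm (arcPath 1 one_ne_zero) 8 (by norm_num))

/-! ## §3 The homotopy must live in the curve: ambient homotopy makes homotopy coherence false -/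

/-- The arcs are continuous on `ℝ`. [folklore] -/
theorem continuous_arcFun {s : ℚ} (hs : s ≠ 0) : Continuous (arcFun s) := by
  have hD : Continuous (D s) := by
    unfold D
    fun_prop
  refine continuous_pi fun i => ?_
  fin_cases i
  · exact hD
  · exact hD.inv₀ fun t => D_ne_zero hs t

/-- The arc `s` as a `Path` in the AMBIENT space `ℂ²` from `(−1,−1)` to `(1,1)`. [folklore] -/
def arcAmbientPath (s : ℚ) (hs : s ≠ 0) : Path (arcFun 1 0) (arcFun 1 1) where
  toFun t := arcFun s t
  continuous_toFun := (continuous_arcFun hs).comp continuous_subtype_val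
  source' := by
    show arcFun s 0 = arcFun 1 0
    simp only [arcFun, D_at_zero]
  target' := by
    show arcFun s 1 = arcFun 1 1
    simp only [arcFun, D_at_one]

/-- `stub_homotopyInvariance` with the homotopy taken in the AMBIENT space `ℂⁿ` (`x y : Fin Z.n → ℂ`, `Path x y` in `ℂⁿ`)
instead of the subtype `↥Z.points` (refuter-posited test variant; the chart / path-subset / cell hypotheses of the stub are
true statements and are omitted). -/
def HomotopyInvarianceAmbient : Prop :=
  ∀ (Z : CurveData), Z.IsSmoothAffineCurve → ∀ (ω : Fin Z.n → MvPolynomial (Fin Z.n) ℂ), (∀ i, HasAlgCoeffs (ω i)) →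
    ∀ (a : ℂ), IsAlgebraic ℚ a → ∀ (γ₀ γ₁ : CurvePath Z), IsSAPath γ₀.toFun → IsSAPath γ₁.toFun →
    (∃ (x y : Fin Z.n → ℂ) (p₀ p₁ : Path x y), (∀ t : I, γ₀.toFun t = p₀ t) ∧ (∀ t : I, γ₁.toFun t = p₁ t) ∧
      p₀.Homotopic p₁) →
    ∀ (r₀ r₁ : KZ.IntegralRep 1), Realises r₀ a ω γ₀.toFun → Realises r₁ a ω γ₁.toFun → KZ.of r₀ - KZ.of r₁ ∈ M₁

/-- **The homotopy must live in the curve.** With an ambient homotopy in `ℂⁿ` homotopy coherence is FALSE: `ℂ²` is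
contractible, hence simply connected, so the two arcs `x = (2t−1) ± i(t²−t)` on `𝔾ₘ` are homotopic rel end points there,
while their real realisations of `i · y dx` differ in value (`value [arc₁] − value [arc₋₁] < 0`) and so are not congruent
modulo the sound subgroup `M₁`. (In `𝔾ₘ` itself the arcs are not homotopic — they differ by the loop around the
puncture — and `stub_homotopyInvariance`, typed in the subtype, rightly does not identify them.)
[cite: KontsevichZagier2001, §1.2] -/
theorem homotopyInvariance_false_with_ambient_homotopy : ¬ HomotopyInvarianceAmbient := by
  intro h
  haveI : SimplyConnectedSpace (Fin 2 → ℂ) := SimplyConnectedSpace.ofContractible _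
  have hhom : (arcAmbientPath 1 one_ne_zero).Homotopic (arcAmbientPath (-1) (by norm_num)) :=
    SimplyConnectedSpace.paths_homotopic _ _
  have hmem := h Gm isSmoothAffineCurve_Gm omegaGm hasAlgCoeffs_omegaGm Complex.I isAlgebraic_I
    (arcPath 1 one_ne_zero) (arcPath (-1) (by norm_num)) (isSAPath_arcFun one_ne_zero) (isSAPath_arcFun (by norm_num))
    ⟨arcFun 1 0, arcFun 1 1, arcAmbientPath 1 one_ne_zero, arcAmbientPath (-1) (by norm_num), fun _ => rfl,
      fun _ => rfl, hhom⟩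
    (arcRep 1 one_ne_zero) (arcRep (-1) (by norm_num)) ⟨rfl, fun _ _ => rfl⟩ ⟨rfl, fun _ _ => rfl⟩
  have h0 := eval_eq_zero_of_mem_M₁ hmem
  rw [map_sub, KZ.eval_of, KZ.eval_of] at h0
  linarith [value_arcRep_one_sub_neg_one]

end Summit.KontsevichZagierPeriods.SymplecticScissors.RealOnePeriodRelationsNegative.Stubs

end
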